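import Literature.Analysis.FluidPDE.JiaSverak2014TimePairing
import Literature.Analysis.FluidPDE.JiaSverak2014TimeRemainder
import Literature.Analysis.FluidPDE.JiaSverak2014PressureSlices
import Literature.Analysis.FluidPDE.NSSliceTimeBumps
import HarnessLib

/-!
# Jia–Šverák 2014, local higher regularity: spatial derivatives are Lipschitz in time

Analysis/FluidPDE proofs file (theorems only; no definitions, no named facts), part of the proof
of the named fact `Literature.Analysis.FluidPDE.jia_sverak_2014_local_higher_regularity`
(`JiaSverak2014LocalRegularity.lean`; H. Jia, V. Šverák, Invent. Math. 196 (2014) =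
arXiv:1204.0529, §4 proof of Thm 4.1: `‖∂ₜ∂ₓ^α u‖_{L^∞(B_{1/8}(x₀)×[0,T₂])} ≤ C(α, u₀)`). Given a
time-dependent representative `R(t) ∈ C^{m+2,γ}` (constant `𝒞`) of the local Leray solution on
`(0,T_b) × B(x₀,ρ)`, the derivatives `DᵐR(t)` are Lipschitz in time on a full-measure set of
times, uniformly on `B(x₀,ρ')`, and `‖DᵐR(t) - Dᵐu₀‖ ≤ L t` there: the pairings of `u` with the
test fields `Dᵐρ_{q,δ}[W∘rev] eᵢ` (translated normalised bumps) are primitives with the datum as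
initial value (`pairing_primitive`), their derivatives are bounded by `Θ` at almost every time
(`remainder_bound`), and bounds on bump pairings of Lipschitz slices give pointwise bounds
(`norm_sub_le_of_bump_pairings`).

* `time_lipschitz` — the statement above.

## References

* H. Jia, V. Šverák, Invent. Math. 196 (2014) = arXiv:1204.0529, §4. Bib key `JiaSverak2014`.
* J. C. Robinson, J. L. Rodrigo, W. Sadowski, *The Three-Dimensional Navier–Stokes Equations*
  (2016), Lemma 13.8. Bib key `RobinsonRodrigoSadowski2016`.
-/

noncomputable section

open MeasureTheory TopologicalSpace Set Function Filter Metric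
open _root_.Topology
open scoped ENNReal NNReal RealInnerProductSpace Laplacian ContDiff

namespace Literature.Analysis.FluidPDE

namespace JiaSverak2014

open IteratedIBP Literature.Analysis.UnboundedOperators LemarieRieusset2016

-- nested operator types
set_option maxSynthPendingDepth 3

/-! ## Elementary lemmas -/

/-- If `a ≤ c/(n+2) + b` for all `n` then `a ≤ b`. [folklore] -/
theorem le_of_forall_le_div_add {a b c : ℝ} (h : ∀ n : ℕ, a ≤ c / (n + 2) + b) : a ≤ b := by
  refine le_of_forall_pos_lt_add fun ε hε => ?_
  obtain ⟨n, hn⟩ := exists_nat_gt (c / ε)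
  have h1 : c / ((n : ℝ) + 2) < ε := by
    rw [div_lt_iff₀ (by positivity)]
    rw [div_lt_iff₀ hε] at hn
    nlinarith
  linarith [h n]

/-- A smooth global modification of a datum smooth on `B(x₀, 1)`, equal to it on `B̄(x₀, 7/24)`. [folklore] -/
theorem exists_smooth_globalisation {u₀ : (EuclideanSpace ℝ (Fin 3)) → (EuclideanSpace ℝ (Fin 3))} {x₀ : EuclideanSpace ℝ (Fin 3)}
    (hu₀ : ContDiffOn ℝ ∞ u₀ (ball x₀ 1)) (m : ℕ) :
    ∃ v : (EuclideanSpace ℝ (Fin 3)) → (EuclideanSpace ℝ (Fin 3)), ContDiff ℝ m v ∧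
      ∀ x ∈ ball x₀ (1 / 2), v =ᶠ[𝓝 x] u₀ := by
  let χ : ContDiffBump x₀ := ⟨1 / 2, 3 / 4, by norm_num, by norm_num⟩
  have hχs : ContDiff ℝ ∞ (χ : (EuclideanSpace ℝ (Fin 3)) → ℝ) := χ.contDiff
  have hχsupp : tsupport (χ : (EuclideanSpace ℝ (Fin 3)) → ℝ) = closedBall x₀ (3 / 4) := χ.tsupport_eq
  set v : (EuclideanSpace ℝ (Fin 3)) → (EuclideanSpace ℝ (Fin 3)) := fun y => (χ : _ → ℝ) y • u₀ y with hv
  have hcb : closedBall x₀ (3 / 4 : ℝ) ⊆ ball x₀ 1 := closedBall_subset_ball (by norm_num)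
  have hvU : ContDiffOn ℝ ∞ v (ball x₀ 1) := hχs.contDiffOn.smul hu₀
  have hv0 : ∀ y, y ∉ closedBall x₀ (3 / 4 : ℝ) → v =ᶠ[𝓝 y] fun _ => 0 := fun y hy => by
    have h : (χ : (EuclideanSpace ℝ (Fin 3)) → ℝ) =ᶠ[𝓝 y] fun _ => 0 :=
      notMem_tsupport_iff_eventuallyEq.1 (by rwa [hχsupp])
    exact h.mono fun z hz => by simp only [hv, hz, zero_smul]
  refine ⟨v, ?_, ?_⟩
  · refine contDiff_iff_contDiffAt.2 fun y => ?_
    by_cases hy : y ∈ closedBall x₀ (3 / 4 : ℝ)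
    · exact (hvU.of_le (by exact_mod_cast le_top)).contDiffAt (isOpen_ball.mem_nhds (hcb hy))
    · exact (contDiffAt_const (c := (0 : EuclideanSpace ℝ (Fin 3)))).congr_of_eventuallyEq (hv0 y hy)
  · intro x hx
    filter_upwards [isOpen_ball.mem_nhds hx] with y hy
    simp only [hv, χ.one_of_mem_closedBall (ball_subset_closedBall hy), one_smul]

/-- Lipschitz bound for `y ↦ Dᵐu₀(y)[W]` on a ball where `‖Dᵐ⁺¹u₀‖ ≤ A`. [folklore] -/
theorem norm_iteratedFDeriv_apply_sub_le_on_ball {m : ℕ} {u₀ : (EuclideanSpace ℝ (Fin 3)) → (EuclideanSpace ℝ (Fin 3))}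
    {x₀ : EuclideanSpace ℝ (Fin 3)} {r A : ℝ} (hu₀ : ContDiffOn ℝ ∞ u₀ (ball x₀ r))
    (hA : ∀ x ∈ ball x₀ r, ‖iteratedFDeriv ℝ (m + 1) u₀ x‖ ≤ A) (W : Fin m → EuclideanSpace ℝ (Fin 3))
    {x y : EuclideanSpace ℝ (Fin 3)} (hx : x ∈ ball x₀ r) (hy : y ∈ ball x₀ r) :
    ‖iteratedFDeriv ℝ m u₀ x W - iteratedFDeriv ℝ m u₀ y W‖ ≤ A * (∏ k, ‖W k‖) * ‖x - y‖ := by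
  have hdiff : ∀ z ∈ ball x₀ r, DifferentiableAt ℝ (iteratedFDeriv ℝ m u₀) z := fun z hz =>
    (hu₀.contDiffAt (isOpen_ball.mem_nhds hz)).differentiableAt_iteratedFDeriv (by exact_mod_cast ENat.coe_lt_top m)
  have hbound : ∀ z ∈ ball x₀ r, ‖fderiv ℝ (iteratedFDeriv ℝ m u₀) z‖ ≤ A := fun z hz => by
    rw [norm_fderiv_iteratedFDeriv]; exact hA z hz
  have hmv : ‖iteratedFDeriv ℝ m u₀ x - iteratedFDeriv ℝ m u₀ y‖ ≤ A * ‖x - y‖ :=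
    (convex_ball x₀ r).norm_image_sub_le_of_norm_fderiv_le hdiff hbound hy hx
  calc ‖iteratedFDeriv ℝ m u₀ x W - iteratedFDeriv ℝ m u₀ y W‖
      = ‖(iteratedFDeriv ℝ m u₀ x - iteratedFDeriv ℝ m u₀ y) W‖ := rfl
    _ ≤ ‖iteratedFDeriv ℝ m u₀ x - iteratedFDeriv ℝ m u₀ y‖ * ∏ k, ‖W k‖ := ContinuousMultilinearMap.le_opNorm _ _
    _ ≤ A * ‖x - y‖ * ∏ k, ‖W k‖ := mul_le_mul_of_nonneg_right hmv (Finset.prod_nonneg fun _ _ => norm_nonneg _)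
    _ = A * (∏ k, ‖W k‖) * ‖x - y‖ := by ring

/-- From a pointwise Lipschitz bound on a set to `HolderOnWith _ 1`. [folklore] -/
theorem holderOnWith_one_of_norm_sub_le {f : (EuclideanSpace ℝ (Fin 3)) → (EuclideanSpace ℝ (Fin 3))} {s : Set (EuclideanSpace ℝ (Fin 3))}
    {C : ℝ} (h : ∀ x ∈ s, ∀ y ∈ s, ‖f x - f y‖ ≤ C * ‖x - y‖) : HolderOnWith C.toNNReal 1 f s := by
  rw [holderOnWith_one]
  refine LipschitzOnWith.of_dist_le_mul fun x hx y hy => ?_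
  rw [dist_eq_norm, dist_eq_norm]
  exact (h x hx y hy).trans (mul_le_mul_of_nonneg_right (Real.le_coe_toNNReal C) (norm_nonneg _))

/-- The difference of the primitives `∫_{(0,t]} f - ∫_{(0,s]} f` is bounded by `Θ |t - s|` when
`|f| ≤ Θ` a.e. on `(0, T)` and `s, t ∈ (0, T)`. [folklore] -/
theorem abs_setIntegral_Ioc_sub_le {f : ℝ → ℝ} {T Θ : ℝ} (hf : IntegrableOn f (Ioo 0 T))
    (hb : ∀ᵐ τ ∂(volume.restrict (Ioo 0 T)), |f τ| ≤ Θ) {s t : ℝ} (hs : s ∈ Ioo 0 T) (ht : t ∈ Ioo 0 T) :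
    |(∫ τ in Ioc 0 t, f τ) - ∫ τ in Ioc 0 s, f τ| ≤ Θ * |t - s| := by
  -- reduce to `s ≤ t`
  wlog hst : s ≤ t generalizing s t
  · have h := this ht hs (le_of_not_ge hst)
    rw [abs_sub_comm (∫ τ in Ioc 0 s, f τ), abs_sub_comm s t] at h
    exact h
  -- integrability on `(0, t]` up to the null endpoint
  have hIt : ∀ r ∈ Ioo 0 T, IntegrableOn f (Ioc 0 r) := fun r hr => by
    have h1 : IntegrableOn f (Ioo 0 r) := hf.mono_set (Ioo_subset_Ioo_right hr.2.le)
    rwa [integrableOn_Ioc_iff_integrableOn_Ioo' (by simp)] 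
  have hunion : Ioc 0 s ∪ Ioc s t = Ioc 0 t := Ioc_union_Ioc_eq_Ioc hs.1.le hst
  have hdisj : Disjoint (Ioc 0 s) (Ioc s t) := Ioc_disjoint_Ioc_of_le le_rfl
  have hst' : IntegrableOn f (Ioc s t) := (hIt t ht).mono_set (Ioc_subset_Ioc_left hs.1.le)
  have e1 : (∫ τ in Ioc 0 t, f τ) = (∫ τ in Ioc 0 s, f τ) + ∫ τ in Ioc s t, f τ := by
    rw [← hunion, setIntegral_union hdisj measurableSet_Ioc (hIt s hs) hst']
  rw [e1, add_sub_cancel_left]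
  have hbd : ∀ᵐ τ ∂(volume.restrict (Ioc s t)), ‖f τ‖ ≤ Θ := by
    have hsub : Ioc s t ⊆ Ioo 0 T ∪ {t} := fun τ hτ => by
      rcases eq_or_lt_of_le hτ.2 with h | h
      · exact Or.inr h
      · exact Or.inl ⟨hs.1.trans hτ.1, h.trans ht.2⟩
    have hnull : (volume.restrict (Ioc s t)) ≤ volume.restrict (Ioo 0 T) + volume.restrict ({t} : Set ℝ) := by
      calc volume.restrict (Ioc s t) ≤ volume.restrict (Ioo 0 T ∪ {t}) := Measure.restrict_mono hsub le_rfl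
        _ ≤ _ := Measure.restrict_union_le _ _
    have h2 : ∀ᵐ τ ∂(volume.restrict (Ioo 0 T) + volume.restrict ({t} : Set ℝ)), ‖f τ‖ ≤ Θ := by
      rw [ae_add_measure_iff]
      refine ⟨hb.mono fun τ hτ => by rwa [Real.norm_eq_abs], ?_⟩
      rw [Measure.restrict_singleton, Real.volume_singleton, zero_smul, ae_zero]; exact eventually_bot
    exact ae_mono hnull h2
  have h := norm_setIntegral_le_of_norm_le_const_ae (measure_Ioc_lt_top) hbd
  rw [Real.norm_eq_abs, Real.volume_real_Ioc_of_le hst] at h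
  rwa [abs_of_nonneg (sub_nonneg.2 hst)]

/-- The gauged pressure is integrable on finite cylinders (from `p ∈ L^{3/2}_loc`, `c ∈ L^{3/2}`). [folklore] -/
theorem integrableOn_gaugedPressure_cylinder {T' : ℝ} {x₀ : EuclideanSpace ℝ (Fin 3)}
    {u₀ : (EuclideanSpace ℝ (Fin 3)) → (EuclideanSpace ℝ (Fin 3))}
    {u : ℝ → (EuclideanSpace ℝ (Fin 3)) → (EuclideanSpace ℝ (Fin 3))} {p : ℝ → (EuclideanSpace ℝ (Fin 3)) → ℝ}
    {Tb' : ℝ} (hu : IsLocalLeraySolutionOn T' 1 u₀ u p) (hTb'T' : Tb' ≤ T')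
    {cg : ℝ → ℝ} (hcg : MemLp cg (3 / 2 : ℝ≥0∞) (volume.restrict (Ioo 0 T'))) (r : ℝ) :
    IntegrableOn (fun z : ℝ × EuclideanSpace ℝ (Fin 3) => p z.1 z.2 - cg z.1) (Ioo 0 Tb' ×ˢ closedBall x₀ r) volume := by
  have hu'' : IsLocalLeraySolutionOn Tb' 1 u₀ u p := hu.mono hTb'T'
  have hK : IsCompact (closedBall x₀ r) := isCompact_closedBall _ _
  haveI : IsFiniteMeasure ((volume : Measure (ℝ × (EuclideanSpace ℝ (Fin 3)))).restrict (Ioo 0 Tb' ×ˢ closedBall x₀ r)) :=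
    ⟨by rw [Measure.restrict_apply_univ]; exact volume_Ioo_prod_lt_top hK⟩
  have hsub : Ioo 0 Tb' ×ˢ closedBall x₀ r ⊆ ((slab (EuclideanSpace ℝ (Fin 3)) (Ioo 0 Tb') isOpen_Ioo :
      Opens (ℝ × (EuclideanSpace ℝ (Fin 3)))) : Set (ℝ × (EuclideanSpace ℝ (Fin 3)))) :=
    fun z hz => mem_slab.2 hz.1
  have hp1 : IntegrableOn (uncurry p) (Ioo 0 Tb' ×ˢ closedBall x₀ r) volume := by
    have hm : AEStronglyMeasurable (uncurry p)
        ((volume : Measure (ℝ × (EuclideanSpace ℝ (Fin 3)))).restrict (Ioo 0 Tb' ×ˢ closedBall x₀ r)) :=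
      (hu''.suitable.distributional.2.2.1.mono_set hsub).aestronglyMeasurable
    exact BradshawTsai2019.integrable_of_lintegral_rpow_enorm_lt_top hm (by norm_num : (1 : ℝ) ≤ 3 / 2) (hu''.pressure _ hK)
  have hc1 : IntegrableOn (fun z : ℝ × (EuclideanSpace ℝ (Fin 3)) => cg z.1) (Ioo 0 Tb' ×ˢ closedBall x₀ r) volume := by
    haveI : IsFiniteMeasure ((volume : Measure ℝ).restrict (Ioo 0 Tb')) := ⟨by
      rw [Measure.restrict_apply_univ]; exact measure_Ioo_lt_top⟩
    have h32 : (1 : ℝ≥0∞) ≤ 3 / 2 :=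
      ((ENNReal.lt_div_iff_mul_lt (Or.inl two_ne_zero) (Or.inl ENNReal.ofNat_ne_top)).2 (by norm_num)).le
    have hcT : MemLp cg (3 / 2 : ℝ≥0∞) (volume.restrict (Ioo 0 Tb')) :=
      hcg.mono_measure (Measure.restrict_mono (Ioo_subset_Ioo_right hTb'T') le_rfl)
    have hci : Integrable cg ((volume : Measure ℝ).restrict (Ioo 0 Tb')) := hcT.integrable h32
    haveI : IsFiniteMeasure ((volume : Measure (EuclideanSpace ℝ (Fin 3))).restrict (closedBall x₀ r)) :=
      ⟨by rw [Measure.restrict_apply_univ]; exact hK.measure_lt_top⟩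
    have h1 : Integrable (fun _ : EuclideanSpace ℝ (Fin 3) => (1 : ℝ))
        ((volume : Measure (EuclideanSpace ℝ (Fin 3))).restrict (closedBall x₀ r)) := integrable_const _
    have h := hci.mul_prod h1
    rw [IntegrableOn, Measure.volume_eq_prod, ← Measure.prod_restrict]
    simpa using h
  exact hp1.sub hc1

/-- The normalised bump translate: support, test-function property, unit mass. [folklore] -/
theorem bump_translate_facts (φ : ContDiffBump (0 : EuclideanSpace ℝ (Fin 3))) (q : EuclideanSpace ℝ (Fin 3)) :
    ContDiff ℝ ∞ (fun z : EuclideanSpace ℝ (Fin 3) => φ.normed volume (z - q)) ∧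
      tsupport (fun z : EuclideanSpace ℝ (Fin 3) => φ.normed volume (z - q)) ⊆ closedBall q φ.rOut ∧
      (∀ z, 0 ≤ φ.normed volume (z - q)) ∧ ∫ z : EuclideanSpace ℝ (Fin 3), ‖φ.normed volume (z - q)‖ = 1 := by
  refine ⟨φ.contDiff_normed.comp (contDiff_id.sub contDiff_const), ?_, fun z => φ.nonneg_normed _, ?_⟩
  · refine closure_minimal (fun z hz => ?_) isClosed_closedBall
    by_contra h
    rw [mem_closedBall, not_le] at h
    refine hz ?_
    simp only [φ.normed_def]
    rw [φ.zero_of_le_dist (by simpa [dist_eq_norm] using h.le), zero_div]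
  · have h1 : ∀ z, ‖φ.normed volume (z - q)‖ = φ.normed volume (z - q) := fun z => by
      rw [Real.norm_eq_abs, abs_of_nonneg (φ.nonneg_normed _)]
    simp_rw [h1]
    exact integral_bump_sub φ q

set_option maxHeartbeats 12800000 in
/-- **The spatial derivatives of a time-dependent smooth representative are Lipschitz in time,
a.e., with the datum as value at `t = 0`.** For `m`, `0 < γ < 1`, `0 < ρ' < ρ ≤ 7/24`, `K_b ≥ 0`,
`α_u`, `𝒞 ≥ 0` and datum bounds `A_d` there is `L ≥ 0` such that: for every local Leray
solution `(u,p)` on `(0,T') × ℝ³` (measurable datum smooth on `B(x₀,1)` with `‖Dᵏu₀‖ ≤ A_d k`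
there), `0 < T_b ≤ T_b' ≤ T'`, `|u| ≤ K_b` a.e. on `(0,T_b') × B(x₀,7/12)`, uniformly local energy
`≤ α_u`, and every family `R(t) ∈ C^{m+2,γ}` (constant `𝒞`) with `R(t) = u(t)` a.e. on `B(x₀,ρ)`
for a.e. `t < T_b`, there is a full-measure set `G ⊆ (0,T_b)` of times with
`‖DᵐR(t)(x) - DᵐR(s)(x)‖ ≤ L |t - s|` and `‖DᵐR(t)(x) - Dᵐu₀(x)‖ ≤ L t` for `t, s ∈ G`,
`x ∈ B(x₀, ρ')`. [cite: JiaSverak2014, §4 proof of Thm 4.1] [cite: RobinsonRodrigoSadowski2016, Lemma 13.8] -/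
theorem time_lipschitz (m : ℕ) {γ : ℝ} (hγ0 : 0 < γ) (hγ1 : γ < 1) {ρ ρ' : ℝ} (hρ' : 0 < ρ') (hρ'ρ : ρ' < ρ)
    (hρ : ρ ≤ 7 / 24) {Kb : ℝ} (hKb : 0 ≤ Kb) (αu : ℝ≥0) {𝒞 : ℝ} (h𝒞 : 0 ≤ 𝒞) (Ad : ℕ → ℝ) :
    ∃ L : ℝ, 0 ≤ L ∧ ∀ {T' : ℝ} {x₀ : EuclideanSpace ℝ (Fin 3)}
      {u₀ : (EuclideanSpace ℝ (Fin 3)) → (EuclideanSpace ℝ (Fin 3))}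
      {u : ℝ → (EuclideanSpace ℝ (Fin 3)) → (EuclideanSpace ℝ (Fin 3))} {p : ℝ → (EuclideanSpace ℝ (Fin 3)) → ℝ}
      {Tb Tb' : ℝ},
      AEStronglyMeasurable u₀ volume → IsLocalLeraySolutionOn T' 1 u₀ u p →
      0 < Tb → Tb ≤ Tb' → Tb' ≤ T' →
      ContDiffOn ℝ ∞ u₀ (ball x₀ 1) → (∀ k, ∀ x ∈ ball x₀ 1, ‖iteratedFDeriv ℝ k u₀ x‖ ≤ Ad k) →
      (∀ᵐ z ∂(volume.restrict (Ioo 0 Tb' ×ˢ ball x₀ (7 / 12))), ‖u z.1 z.2‖ ≤ Kb) →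
      (∀ᵐ t ∂(volume.restrict (Ioo 0 T')), ∀ z : EuclideanSpace ℝ (Fin 3), ∫⁻ x in ball z 1, ‖u t x‖ₑ ^ 2 ≤ αu) →
      ∀ (R : ℝ → (EuclideanSpace ℝ (Fin 3)) → (EuclideanSpace ℝ (Fin 3))),
      (∀ t, IsHolderField (m + 2) γ 𝒞 (R t)) →
      (∀ᵐ t ∂(volume.restrict (Ioo 0 Tb)), ∀ᵐ x ∂(volume.restrict (ball x₀ ρ)), R t x = u t x) →
      ∃ G : Set ℝ, G ⊆ Ioo 0 Tb ∧ (∀ᵐ t ∂(volume.restrict (Ioo 0 Tb)), t ∈ G) ∧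
        (∀ t ∈ G, ∀ s ∈ G, ∀ x ∈ ball x₀ ρ',
          ‖iteratedFDeriv ℝ m (R t) x - iteratedFDeriv ℝ m (R s) x‖ ≤ L * |t - s|) ∧
        (∀ t ∈ G, ∀ x ∈ ball x₀ ρ', ‖iteratedFDeriv ℝ m (R t) x - iteratedFDeriv ℝ m u₀ x‖ ≤ L * t) := by
  classical
  set b : OrthonormalBasis (Fin 3) ℝ (EuclideanSpace ℝ (Fin 3)) := EuclideanSpace.basisFun (Fin 3) ℝ with hb_def
  have hb1 : ∀ i, ‖b i‖ = 1 := fun i => b.orthonormal.1 i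
  -- ## universal constants
  set d : ℝ := (ρ - ρ') / 4 with hd
  have hd0 : 0 < d := by rw [hd]; linarith
  have hρd : 4 * d ≤ ρ := by rw [hd]; linarith
  have hρ'eq : ρ' = ρ - 4 * d := by rw [hd]; ring
  obtain ⟨Pq, hPq0, hPS⟩ := pressure_slices hKb αu
  obtain ⟨Θ, hΘ0, hRB⟩ := remainder_bound m hγ0 hγ1 hd0 hρd hρ h𝒞 hPq0
  set L : ℝ := (3 : ℝ) ^ m * (3 * Θ) with hL
  have hL0 : 0 ≤ L := by positivity
  refine ⟨L, hL0, ?_⟩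
  intro T' x₀ u₀ u p Tb Tb' hm₀ hu hTb hTbTb' hTb'T' hu₀ hAd hbd hαu R hRH hRu
  have hTb' : 0 < Tb' := hTb.trans_le hTbTb'
  -- dense centres and shrinking bumps
  obtain ⟨q, hq⟩ := TopologicalSpace.exists_dense_seq (EuclideanSpace ℝ (Fin 3))
  have hδ : ∀ n : ℕ, 0 < d / ((n : ℝ) + 2) := fun n => by positivity
  have hδd : ∀ n : ℕ, d / ((n : ℝ) + 2) < d := fun n => by
    rw [div_lt_iff₀ (by positivity)]; nlinarith
  set φb : ℕ → ContDiffBump (0 : EuclideanSpace ℝ (Fin 3)) := fun n =>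
    ⟨d / ((n : ℝ) + 2) / 2, d / ((n : ℝ) + 2), by positivity, by linarith [hδ n]⟩ with hφb
  have hrOut : ∀ n, (φb n).rOut = d / ((n : ℝ) + 2) := fun n => rfl
  -- the scalar bumps, their derivative tests and the test fields
  set φs : ℕ → ℕ → (EuclideanSpace ℝ (Fin 3)) → ℝ := fun n k z => (φb n).normed volume (z - q k) with hφs
  set φt : ℕ → ℕ → (Fin m → Fin 3) → (EuclideanSpace ℝ (Fin 3)) → ℝ := fun n k ι y =>
    iteratedFDeriv ℝ m (φs n k) y (fun j => b (ι (Fin.rev j))) with hφt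
  set Φ : ℕ → ℕ → (Fin m → Fin 3) → Fin 3 → (EuclideanSpace ℝ (Fin 3)) → (EuclideanSpace ℝ (Fin 3)) :=
    fun n k ι i y => φt n k ι y • b i with hΦ
  have hφs_facts := fun n k => bump_translate_facts (φb n) (q k)
  have hφt_eq : ∀ n k ι y, φt n k ι y = iteratedFDeriv ℝ m (φs n k) y (fun j => (fun j' => b (ι j')) (Fin.rev j)) :=
    fun n k ι y => rfl
  -- supports when the centre is in `B(x₀, ρ')`
  have hsupp : ∀ n k, q k ∈ ball x₀ ρ' → tsupport (φs n k) ⊆ ball x₀ (ρ - 2 * d) := by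
    intro n k hk
    refine (hφs_facts n k).2.1.trans fun z hz => ?_
    rw [mem_closedBall, hrOut] at hz
    rw [mem_ball] at hk ⊢
    calc dist z x₀ ≤ dist z (q k) + dist (q k) x₀ := dist_triangle _ _ _
      _ < d / ((n : ℝ) + 2) + ρ' := add_lt_add_of_le_of_lt hz hk
      _ ≤ ρ - 2 * d := by rw [hρ'eq]; linarith [hδd n]
  have hΦtest : ∀ n k ι i, q k ∈ ball x₀ ρ' →
      FunctionSpaces.IsTestFunctionOn (⟨ball x₀ (7 / 24), isOpen_ball⟩ : Opens (EuclideanSpace ℝ (Fin 3))) (Φ n k ι i) := by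
    intro n k ι i hk
    have h1 : ContDiff ℝ ∞ (φt n k ι) := contDiff_iteratedFDeriv_apply_const (hφs_facts n k).1 _
    have h2 : HasCompactSupport (φt n k ι) := by
      refine hasCompactSupport_iteratedFDeriv_apply_const ?_ _
      exact HasCompactSupport.of_support_subset_isCompact (isCompact_closedBall (q k) (φb n).rOut)
        ((subset_tsupport _).trans (hφs_facts n k).2.1)
    have h3 : tsupport (φt n k ι) ⊆ ball x₀ (7 / 24) :=
      ((tsupport_iteratedFDeriv_apply_const_subset _ _).trans (hsupp n k hk)).trans (ball_subset_ball (by linarith))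
    refine ⟨h1.smul contDiff_const, h2.smul_right, ?_⟩
    exact (tsupport_smul_subset_left _ _).trans h3
  -- ## the pressure on slices, the gauge
  obtain ⟨cg, hcg, hslices⟩ := hPS hm₀ hu hTb' hTb'T' hbd hαu
  have hpI := integrableOn_gaugedPressure_cylinder hu hTb'T' hcg (7 / 24 : ℝ) (x₀ := x₀) (Tb' := Tb')
  -- ## the pairings and remainders
  set gΦ : ℕ → ℕ → (Fin m → Fin 3) → Fin 3 → ℝ → ℝ := fun n k ι i t => ∫ x, ⟪u t x, Φ n k ι i x⟫ with hgΦ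
  set fΦ : ℕ → ℕ → (Fin m → Fin 3) → Fin 3 → ℝ → ℝ := fun n k ι i t =>
    ∫ x, (⟪u t x, fderiv ℝ (Φ n k ι i) x (u t x)⟫ + ⟪u t x, Δ (Φ n k ι i) x⟫ +
      (p t x - cg t) * VectorCalculus.divergence (Φ n k ι i) x) with hfΦ
  set cΦ : ℕ → ℕ → (Fin m → Fin 3) → Fin 3 → ℝ := fun n k ι i => ∫ x, ⟪u₀ x, Φ n k ι i x⟫ with hcΦ
  -- integrability of the remainder in time
  have hu'' : IsLocalLeraySolutionOn Tb' 1 u₀ u p := hu.mono hTb'T'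
  have hfI : ∀ n k ι i, q k ∈ ball x₀ ρ' → IntegrableOn (fΦ n k ι i) (Ioo 0 Tb') := by
    intro n k ι i hk
    have hT := hΦtest n k ι i hk
    have h := integrable_remainder_integrand (q := fun s x => p s x - cg s) hu''.aestronglyMeasurable hbd hpI
      (hT.contDiff.of_le (by norm_cast)) (hT.tsupport_subset.trans ball_subset_closedBall)
    exact h.integral_prod_left
  -- the primitive identities, for a.e. `t < T_b`
  have hprim : ∀ᵐ t ∂(volume.restrict (Ioo 0 Tb)), ∀ n k ι i, q k ∈ ball x₀ ρ' →
      gΦ n k ι i t = cΦ n k ι i + ∫ s in Ioc 0 t, fΦ n k ι i s := by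
    rw [ae_all_iff]; intro n
    rw [ae_all_iff]; intro k
    rw [ae_all_iff]; intro ι
    rw [ae_all_iff]; intro i
    by_cases hk : q k ∈ ball x₀ ρ'
    · have h := pairing_primitive hm₀ hu hTb' hTb'T' hbd hcg hpI (hΦtest n k ι i hk)
      exact (ae_restrict_of_ae_restrict_of_subset (Ioo_subset_Ioo_right hTbTb') h).mono fun t ht _ => ht
    · exact Eventually.of_forall fun t h => absurd h hk
  -- ## good slices: `R = u`, the pressure facts, hence the remainder bound and the pairing formula
  have hslices' := ae_restrict_of_ae_restrict_of_subset (Ioo_subset_Ioo_right hTbTb') hslices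
  have hW1 : ∀ ι : Fin m → Fin 3, ∏ j, ‖(fun j' => b (ι j')) j‖ = 1 := fun ι =>
    Finset.prod_eq_one fun j _ => hb1 (ι j)
  have hrem : ∀ᵐ τ ∂(volume.restrict (Ioo 0 Tb)), ∀ n k ι i, q k ∈ ball x₀ ρ' → |fΦ n k ι i τ| ≤ Θ := by
    filter_upwards [hRu, hslices'] with τ hRτ hsl n k ι i hk
    obtain ⟨-, -, hint, hL1, hpo⟩ := hsl
    have h := hRB (hRH τ) hRτ hint hL1 hpo i (fun j' => b (ι j')) (hφs_facts n k).1 (hsupp n k hk) (hφt_eq n k ι)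
    rw [hW1 ι, mul_one, (hφs_facts n k).2.2.2, mul_one] at h
    exact h
  have hpair : ∀ᵐ τ ∂(volume.restrict (Ioo 0 Tb)), ∀ n k ι i, q k ∈ ball x₀ ρ' →
      gΦ n k ι i τ = (-1 : ℝ) ^ m * ∫ x, ⟪iteratedFDeriv ℝ m (R τ) x (fun j' => b (ι j')), b i⟫ * φs n k x := by
    filter_upwards [hRu] with τ hRτ n k ι i hk
    exact pairing_eq m (le_refl ρ) ((hRH τ).contDiff.of_le (by exact_mod_cast Nat.le_add_right m 2)) hRτ i
      (fun j' => b (ι j')) (hφs_facts n k).1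
      (HasCompactSupport.of_support_subset_isCompact (isCompact_closedBall (q k) (φb n).rOut)
        ((subset_tsupport _).trans (hφs_facts n k).2.1))
      ((hsupp n k hk).trans (ball_subset_ball (by linarith))) (hφt_eq n k ι)
  -- ## the good set
  set G : Set ℝ := {t | t ∈ Ioo 0 Tb ∧ (∀ n k ι i, q k ∈ ball x₀ ρ' → gΦ n k ι i t = cΦ n k ι i + ∫ s in Ioc 0 t, fΦ n k ι i s) ∧
    ∀ n k ι i, q k ∈ ball x₀ ρ' →
      gΦ n k ι i t = (-1 : ℝ) ^ m * ∫ x, ⟪iteratedFDeriv ℝ m (R t) x (fun j' => b (ι j')), b i⟫ * φs n k x} with hG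
  have hGae : ∀ᵐ t ∂(volume.restrict (Ioo 0 Tb)), t ∈ G := by
    filter_upwards [ae_restrict_mem measurableSet_Ioo, hprim, hpair] with t h1 h2 h3
    exact ⟨h1, h2, h3⟩
  refine ⟨G, fun t ht => ht.1, hGae, ?_, ?_⟩
  · -- ## Lipschitz between two good times
    intro t ht s hs x hx
    -- the pairing bounds
    have hPbd : ∀ n k (ι : Fin m → Fin 3) i, q k ∈ ball x₀ ρ' →
        |(∫ y, ⟪iteratedFDeriv ℝ m (R t) y (fun j' => b (ι j')), b i⟫ * φs n k y) -
          ∫ y, ⟪iteratedFDeriv ℝ m (R s) y (fun j' => b (ι j')), b i⟫ * φs n k y| ≤ Θ * |t - s| := by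
      intro n k ι i hk
      have e1 := ht.2.2 n k ι i hk
      have e2 := hs.2.2 n k ι i hk
      have e3 := ht.2.1 n k ι i hk
      have e4 := hs.2.1 n k ι i hk
      have hdiff : gΦ n k ι i t - gΦ n k ι i s = (∫ τ in Ioc 0 t, fΦ n k ι i τ) - ∫ τ in Ioc 0 s, fΦ n k ι i τ := by
        rw [e3, e4]; ring
      have hb' : ∀ᵐ τ ∂(volume.restrict (Ioo 0 Tb)), |fΦ n k ι i τ| ≤ Θ := hrem.mono fun τ hτ => hτ n k ι i hk
      have hint : IntegrableOn (fΦ n k ι i) (Ioo 0 Tb) := (hfI n k ι i hk).mono_set (Ioo_subset_Ioo_right hTbTb')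
      have h := abs_setIntegral_Ioc_sub_le hint hb' hs.1 ht.1
      rw [← hdiff, e1, e2, ← mul_sub, abs_mul, abs_pow, abs_neg, abs_one, one_pow, one_mul] at h
      exact h
    -- from pairings to the point `x`, for each basis tuple
    have hpt : ∀ ι : Fin m → Fin 3,
        ‖iteratedFDeriv ℝ m (R t) x (fun j' => b (ι j')) - iteratedFDeriv ℝ m (R s) x (fun j' => b (ι j'))‖ ≤ 3 * Θ * |t - s| := by
      intro ι
      set W : Fin m → EuclideanSpace ℝ (Fin 3) := fun j' => b (ι j') with hWdef
      set w₁ : (EuclideanSpace ℝ (Fin 3)) → (EuclideanSpace ℝ (Fin 3)) := fun y => iteratedFDeriv ℝ m (R t) y W with hw₁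
      set w₂ : (EuclideanSpace ℝ (Fin 3)) → (EuclideanSpace ℝ (Fin 3)) := fun y => iteratedFDeriv ℝ m (R s) y W with hw₂
      -- Lipschitz of the two slices
      have hLip : ∀ τ, ∀ y z, ‖iteratedFDeriv ℝ m (R τ) y W - iteratedFDeriv ℝ m (R τ) z W‖ ≤ 𝒞 * ‖y - z‖ := by
        intro τ y z
        have h := norm_iteratedFDeriv_apply_sub_le ((hRH τ).contDiff.of_le (by exact_mod_cast Nat.le_succ (m + 1)))
          ((hRH τ).norm_le (m + 1) (Nat.le_succ _)) W y z
        rwa [hW1 ι, mul_one] at h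
      have hH₁ : HolderOnWith (𝒞.toNNReal) 1 w₁ (ball x₀ (ρ - 2 * d)) :=
        holderOnWith_one_of_norm_sub_le fun y _ z _ => hLip t y z
      have hH₂ : HolderOnWith (𝒞.toNNReal) 1 w₂ (ball x₀ (ρ - 2 * d)) :=
        holderOnWith_one_of_norm_sub_le fun y _ z _ => hLip s y z
      have hkey : ∀ n : ℕ, ‖w₁ x - w₂ x‖ ≤ 6 * (𝒞.toNNReal : ℝ) * (d / ((n : ℝ) + 2)) + 3 * Θ * |t - s| := by
        intro n
        have hrout : (φb n).rOut < ρ - 2 * d - ρ' := by rw [hrOut, hρ'eq]; linarith [hδd n]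
        have hpairs : ∀ k i, q k ∈ ball x₀ ρ' →
            |(∫ y in ball x₀ (ρ - 2 * d), ⟪w₁ y, (φb n).normed volume (y - q k) • EuclideanSpace.basisFun (Fin 3) ℝ i⟫) -
              ∫ y in ball x₀ (ρ - 2 * d), ⟪w₂ y, (φb n).normed volume (y - q k) • EuclideanSpace.basisFun (Fin 3) ℝ i⟫| ≤
              Θ * |t - s| := by
          intro k i hk
          have hzero : ∀ (w : (EuclideanSpace ℝ (Fin 3)) → (EuclideanSpace ℝ (Fin 3))) y, y ∉ ball x₀ (ρ - 2 * d) →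
              ⟪w y, (φb n).normed volume (y - q k) • EuclideanSpace.basisFun (Fin 3) ℝ i⟫ = 0 := by
            intro w y hy
            have h0 : (φb n).normed volume (y - q k) = 0 :=
              image_eq_zero_of_notMem_tsupport (f := φs n k) fun h => hy (hsupp n k hk h)
            rw [h0, zero_smul, inner_zero_right]
          have hconv : ∀ (w : (EuclideanSpace ℝ (Fin 3)) → (EuclideanSpace ℝ (Fin 3))),
              (∫ y in ball x₀ (ρ - 2 * d), ⟪w y, (φb n).normed volume (y - q k) • EuclideanSpace.basisFun (Fin 3) ℝ i⟫) =
                ∫ y, ⟪w y, b i⟫ * φs n k y := by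
            intro w
            rw [setIntegral_eq_integral_of_forall_compl_eq_zero (hzero w)]
            refine integral_congr_ae (Eventually.of_forall fun y => ?_)
            simp only [hφs, inner_smul_right, mul_comm, hb_def]
          rw [hconv w₁, hconv w₂]
          exact hPbd n k ι i hk
        have h := norm_sub_le_of_bump_pairings (r := ρ') zero_lt_one hH₁ hH₂ (φb n) hrout hq
          (A := fun _ => Θ) (D := |t - s|) hpairs (by rwa [hρ'eq] at hx ⊢)
        simp only [Finset.sum_const, Finset.card_univ, Fintype.card_fin, nsmul_eq_mul, NNReal.coe_one, Real.rpow_one,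
          hrOut] at h
        calc ‖w₁ x - w₂ x‖ ≤ 6 * (𝒞.toNNReal : ℝ) * (d / ((n : ℝ) + 2)) + (3 : ℝ) * Θ * |t - s| := by
              convert h using 2; push_cast; ring
          _ = _ := rfl
      have hfin := le_of_forall_le_div_add (c := 6 * (𝒞.toNNReal : ℝ) * d) fun n => by
        have := hkey n
        rw [show 6 * (𝒞.toNNReal : ℝ) * (d / ((n : ℝ) + 2)) = 6 * (𝒞.toNNReal : ℝ) * d / ((n : ℝ) + 2) by ring] at this
        exact this
      simpa only [hw₁, hw₂] using hfin
    -- the operator norm through the basis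
    calc ‖iteratedFDeriv ℝ m (R t) x - iteratedFDeriv ℝ m (R s) x‖
        ≤ ∑ ι : Fin m → Fin 3, ‖(iteratedFDeriv ℝ m (R t) x - iteratedFDeriv ℝ m (R s) x) (fun j' => b (ι j'))‖ :=
          norm_le_sum_norm_apply_basisFun _
      _ ≤ ∑ _ι : Fin m → Fin 3, 3 * Θ * |t - s| := Finset.sum_le_sum fun ι _ => hpt ι
      _ = L * |t - s| := by
          simp only [Finset.sum_const, Finset.card_univ, Fintype.card_fun, Fintype.card_fin, nsmul_eq_mul, hL]
          push_cast; ring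
  · -- ## comparison with the datum
    intro t ht x hx
    obtain ⟨v, hvs, hveq⟩ := exists_smooth_globalisation hu₀ m
    have hρ12 : ρ ≤ 1 / 2 := hρ.trans (by norm_num)
    have hvR : ∀ᵐ y ∂(volume.restrict (ball x₀ ρ)), v y = u₀ y := by
      rw [ae_restrict_iff' measurableSet_ball]
      exact Eventually.of_forall fun y hy => (hveq y (ball_subset_ball hρ12 hy)).eq_of_nhds
    have hvD : ∀ y ∈ ball x₀ ρ, iteratedFDeriv ℝ m v y = iteratedFDeriv ℝ m u₀ y := fun y hy =>
      ((hveq y (ball_subset_ball hρ12 hy)).iteratedFDeriv ℝ m).eq_of_nhds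
    -- the datum pairing
    have hc : ∀ n k ι i, q k ∈ ball x₀ ρ' →
        cΦ n k ι i = (-1 : ℝ) ^ m * ∫ y, ⟪iteratedFDeriv ℝ m u₀ y (fun j' => b (ι j')), b i⟫ * φs n k y := by
      intro n k ι i hk
      have h := pairing_eq m (le_refl ρ) hvs hvR i (fun j' => b (ι j')) (hφs_facts n k).1
        (HasCompactSupport.of_support_subset_isCompact (isCompact_closedBall (q k) (φb n).rOut)
          ((subset_tsupport _).trans (hφs_facts n k).2.1))
        ((hsupp n k hk).trans (ball_subset_ball (by linarith))) (hφt_eq n k ι)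
      have h' : (∫ x, ⟪u₀ x, Φ n k ι i x⟫) =
          (-1 : ℝ) ^ m * ∫ y, ⟪iteratedFDeriv ℝ m v y (fun j' => b (ι j')), b i⟫ * φs n k y := h
      rw [show cΦ n k ι i = ∫ x, ⟪u₀ x, Φ n k ι i x⟫ from rfl, h']
      congr 1
      refine integral_congr_ae (Eventually.of_forall fun y => ?_)
      by_cases hy : y ∈ ball x₀ ρ
      · simp only [hvD y hy]
      · have h0 : φs n k y = 0 := image_eq_zero_of_notMem_tsupport fun h' => hy (ball_subset_ball (by linarith) (hsupp n k hk h'))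
        simp only [h0, mul_zero]
    have hPbd : ∀ n k (ι : Fin m → Fin 3) i, q k ∈ ball x₀ ρ' →
        |(∫ y, ⟪iteratedFDeriv ℝ m (R t) y (fun j' => b (ι j')), b i⟫ * φs n k y) -
          ∫ y, ⟪iteratedFDeriv ℝ m u₀ y (fun j' => b (ι j')), b i⟫ * φs n k y| ≤ Θ * t := by
      intro n k ι i hk
      have e1 := ht.2.2 n k ι i hk
      have e3 := ht.2.1 n k ι i hk
      have hb' : ∀ᵐ τ ∂(volume.restrict (Ioc 0 t)), ‖fΦ n k ι i τ‖ ≤ Θ := by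
        have h1 : ∀ᵐ τ ∂(volume.restrict (Ioo 0 Tb)), ‖fΦ n k ι i τ‖ ≤ Θ :=
          hrem.mono fun τ hτ => by rw [Real.norm_eq_abs]; exact hτ n k ι i hk
        have hsub : Ioc 0 t ⊆ Ioo 0 Tb ∪ {t} := fun τ hτ => by
          rcases eq_or_lt_of_le hτ.2 with h | h
          · exact Or.inr h
          · exact Or.inl ⟨hτ.1, h.trans ht.1.2⟩
        have hle : volume.restrict (Ioc 0 t) ≤ volume.restrict (Ioo 0 Tb) + volume.restrict ({t} : Set ℝ) :=
          (Measure.restrict_mono hsub le_rfl).trans (Measure.restrict_union_le _ _)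
        have h2 : ∀ᵐ τ ∂(volume.restrict (Ioo 0 Tb) + volume.restrict ({t} : Set ℝ)), ‖fΦ n k ι i τ‖ ≤ Θ := by
          rw [ae_add_measure_iff]
          refine ⟨h1, ?_⟩
          rw [Measure.restrict_singleton, Real.volume_singleton, zero_smul, ae_zero]; exact eventually_bot
        exact ae_mono hle h2
      have h := norm_setIntegral_le_of_norm_le_const_ae (measure_Ioc_lt_top) hb'
      rw [Real.norm_eq_abs, Real.volume_real_Ioc_of_le ht.1.1.le, sub_zero] at h
      have hdiff : gΦ n k ι i t - cΦ n k ι i = ∫ τ in Ioc 0 t, fΦ n k ι i τ := by rw [e3]; ring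
      rw [← hdiff, e1, hc n k ι i hk, ← mul_sub, abs_mul, abs_pow, abs_neg, abs_one, one_pow, one_mul] at h
      exact h
    have hpt : ∀ ι : Fin m → Fin 3,
        ‖iteratedFDeriv ℝ m (R t) x (fun j' => b (ι j')) - iteratedFDeriv ℝ m u₀ x (fun j' => b (ι j'))‖ ≤ 3 * Θ * t := by
      intro ι
      set W : Fin m → EuclideanSpace ℝ (Fin 3) := fun j' => b (ι j') with hWdef
      set w₁ : (EuclideanSpace ℝ (Fin 3)) → (EuclideanSpace ℝ (Fin 3)) := fun y => iteratedFDeriv ℝ m (R t) y W with hw₁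
      set w₂ : (EuclideanSpace ℝ (Fin 3)) → (EuclideanSpace ℝ (Fin 3)) := fun y => iteratedFDeriv ℝ m u₀ y W with hw₂
      set C : ℝ := max 𝒞 (Ad (m + 1)) with hCdef
      have hLip1 : ∀ y z, ‖w₁ y - w₁ z‖ ≤ C * ‖y - z‖ := by
        intro y z
        have h := norm_iteratedFDeriv_apply_sub_le ((hRH t).contDiff.of_le (by exact_mod_cast Nat.le_succ (m + 1)))
          ((hRH t).norm_le (m + 1) (Nat.le_succ _)) W y z
        rw [hW1 ι, mul_one] at h
        exact h.trans (mul_le_mul_of_nonneg_right (le_max_left _ _) (norm_nonneg _))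
      have hLip2 : ∀ y ∈ ball x₀ (ρ - 2 * d), ∀ z ∈ ball x₀ (ρ - 2 * d), ‖w₂ y - w₂ z‖ ≤ C * ‖y - z‖ := by
        intro y hy z hz
        have hsub1 : ball x₀ (ρ - 2 * d) ⊆ ball x₀ 1 := ball_subset_ball (by linarith)
        have h := norm_iteratedFDeriv_apply_sub_le_on_ball (hu₀.mono hsub1) (fun y hy => hAd (m + 1) y (hsub1 hy)) W hy hz
        rw [hW1 ι, mul_one] at h
        exact h.trans (mul_le_mul_of_nonneg_right (le_max_right _ _) (norm_nonneg _))
      have hH₁ : HolderOnWith (C.toNNReal) 1 w₁ (ball x₀ (ρ - 2 * d)) := holderOnWith_one_of_norm_sub_le fun y _ z _ => hLip1 y z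
      have hH₂ : HolderOnWith (C.toNNReal) 1 w₂ (ball x₀ (ρ - 2 * d)) := holderOnWith_one_of_norm_sub_le hLip2
      have hkey : ∀ n : ℕ, ‖w₁ x - w₂ x‖ ≤ 6 * (C.toNNReal : ℝ) * (d / ((n : ℝ) + 2)) + 3 * Θ * t := by
        intro n
        have hrout : (φb n).rOut < ρ - 2 * d - ρ' := by rw [hrOut, hρ'eq]; linarith [hδd n]
        have hpairs : ∀ k i, q k ∈ ball x₀ ρ' →
            |(∫ y in ball x₀ (ρ - 2 * d), ⟪w₁ y, (φb n).normed volume (y - q k) • EuclideanSpace.basisFun (Fin 3) ℝ i⟫) -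
              ∫ y in ball x₀ (ρ - 2 * d), ⟪w₂ y, (φb n).normed volume (y - q k) • EuclideanSpace.basisFun (Fin 3) ℝ i⟫| ≤
              Θ * t := by
          intro k i hk
          have hzero : ∀ (w : (EuclideanSpace ℝ (Fin 3)) → (EuclideanSpace ℝ (Fin 3))) y, y ∉ ball x₀ (ρ - 2 * d) →
              ⟪w y, (φb n).normed volume (y - q k) • EuclideanSpace.basisFun (Fin 3) ℝ i⟫ = 0 := by
            intro w y hy
            have h0 : (φb n).normed volume (y - q k) = 0 :=
              image_eq_zero_of_notMem_tsupport (f := φs n k) fun h => hy (hsupp n k hk h)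
            rw [h0, zero_smul, inner_zero_right]
          have hconv : ∀ (w : (EuclideanSpace ℝ (Fin 3)) → (EuclideanSpace ℝ (Fin 3))),
              (∫ y in ball x₀ (ρ - 2 * d), ⟪w y, (φb n).normed volume (y - q k) • EuclideanSpace.basisFun (Fin 3) ℝ i⟫) =
                ∫ y, ⟪w y, b i⟫ * φs n k y := by
            intro w
            rw [setIntegral_eq_integral_of_forall_compl_eq_zero (hzero w)]
            refine integral_congr_ae (Eventually.of_forall fun y => ?_)
            simp only [hφs, inner_smul_right, mul_comm, hb_def]
          rw [hconv w₁, hconv w₂]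
          exact hPbd n k ι i hk
        have h := norm_sub_le_of_bump_pairings (r := ρ') zero_lt_one hH₁ hH₂ (φb n) hrout hq
          (A := fun _ => Θ) (D := t) hpairs (by rwa [hρ'eq] at hx ⊢)
        simp only [Finset.sum_const, Finset.card_univ, Fintype.card_fin, nsmul_eq_mul, NNReal.coe_one, Real.rpow_one,
          hrOut] at h
        calc ‖w₁ x - w₂ x‖ ≤ 6 * (C.toNNReal : ℝ) * (d / ((n : ℝ) + 2)) + (3 : ℝ) * Θ * t := by
              convert h using 2; push_cast; ring
          _ = _ := rfl
      have hfin := le_of_forall_le_div_add (c := 6 * (C.toNNReal : ℝ) * d) fun n => by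
        have := hkey n
        rw [show 6 * (C.toNNReal : ℝ) * (d / ((n : ℝ) + 2)) = 6 * (C.toNNReal : ℝ) * d / ((n : ℝ) + 2) by ring] at this
        exact this
      simpa only [hw₁, hw₂] using hfin
    calc ‖iteratedFDeriv ℝ m (R t) x - iteratedFDeriv ℝ m u₀ x‖
        ≤ ∑ ι : Fin m → Fin 3, ‖(iteratedFDeriv ℝ m (R t) x - iteratedFDeriv ℝ m u₀ x) (fun j' => b (ι j'))‖ :=
          norm_le_sum_norm_apply_basisFun _
      _ ≤ ∑ _ι : Fin m → Fin 3, 3 * Θ * t := Finset.sum_le_sum fun ι _ => hpt ι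
      _ = L * t := by
          simp only [Finset.sum_const, Finset.card_univ, Fintype.card_fun, Fintype.card_fin, nsmul_eq_mul, hL]
          push_cast; ring

end JiaSverak2014

end Literature.Analysis.FluidPDE
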